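import Summits.FinalStateConjecture.FinalStateConjecture.Theorems.SwallowTheDatumKerrShieldedSettlesStubExteriorTransportAuxPush
import Summits.FinalStateConjecture.FinalStateConjecture.Theorems.SwallowTheDatumKerrShieldedSettlesStubKerrExteriorDecompositionDeviations
import HarnessLib

set_option linter.dupNamespace false

/-!
# Stub `stub_deviationTransport` (T6) of line `swallow-transfer`, crux `EIHFluxBalance.ModulatedKerrHandoff` (stmt-FinalStateConjecture-10167)

Support file for crux `stmt-FinalStateConjecture-10167`
(`Summit.FinalStateConjecture.FinalStateConjecture.Theses.EIHFluxBalance.ModulatedKerrHandoff`), line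
`swallow-transfer`: the registered stub `stub_deviationTransport` (statement VERBATIM from the registered skeleton).

**Transport of the chart and deviation clauses through the collar embedding.**  Let `χ : Kerr.region a r₁ → 𝒟` be
smooth, an open embedding and isometric on the tapered collar `W = {0 < x⁰ − T(r) + (r − r₁)/4}` (`T = bentHeight M a`),
let `f` be the bent lab chart (smooth on `{x⁰ > τ₀}`, an open embedding of the pinned domain `U = {x⁰ > τ₀, r > r₁}`,
above the leaf `T(r x) < (f x)⁰`, radius preserving), and `Φ = χ ∘ f` on `U`.  Then `f(U) ⊆ W`, so `Φ` is smooth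
(`ContMDiffOn.comp_contMDiff`) and an open embedding of the late region (open embeddings compose; corestrictions to
open subtypes by `Topology.IsOpenEmbedding.of_comp`); the metric deviation of `Φ` from the background
`⟨U, g_{M,a}, x⁰, |x̲|⟩` is the deviation of `f` in the exact Kerr spacetime (`ExteriorTransport.deviation_comp_eq`,
crux 10054), i.e. the explicit zero-extended function `e = 𝟙_U · (g_{M,a}(f ·)(Df ·, Df ·) − g_{M,a})`
(`ExteriorDecomposition.deviation_of_repr`), whose `C³` slab decay and vanishing on the cone `|x̲| ≤ x⁰/2` are the
hypotheses; the weighted cone supremum therefore vanishes identically for every weight.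

References: B. O'Neill, *Semi-Riemannian geometry* (1983), Ch. 3, p. 58; M. Dafermos, G. Holzegel, I. Rodnianski,
M. Taylor, arXiv:2104.08222, §1 (consequence form of convergence, `KerrConvergence`).
-/

noncomputable section

open Set Filter Function TopologicalSpace
open scoped Manifold ContDiff Topology ENNReal
open Literature.Geometry.Lorentzian
open Summit.FinalStateConjecture.FinalStateConjecture.Theorems.KerrShieldedDataExist.Negative
  (bentHeight mass_pos rMinus_nonneg)
open Summit.FinalStateConjecture.FinalStateConjecture.Theorems.SwallowTheDatum.KerrShieldedSettles.ExteriorTransport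
  (deviation_comp_eq)
open Summit.FinalStateConjecture.FinalStateConjecture.Theorems.SwallowTheDatum.KerrShieldedSettles.ExteriorDecomposition
  (contMDiff_of_repr deviation_of_repr)
open Summit.FinalStateConjecture.FinalStateConjecture.Theorems.SwallowTheDatum.KerrShieldedSettles.CollarEmbedsMGHD
  (collar)

namespace Summit.FinalStateConjecture.FinalStateConjecture.Cruxes.ModulatedKerrHandoff.SwallowTransfer

/-- **Open embeddings of nested open subtypes compose.**  If `χ|_W` is an open embedding (`W` open in the open
subset `K ⊆ E4`), `f|_P` is an open embedding (`P ⊆ E4` open) with `f(U) ⊆ K`, `(f(x), ·) ∈ W` for `x ∈ U`, where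
`U` is an open subset of `E4` with underlying set `P`, then for every open `L ⊆ U` the restriction to `L` of
`x ↦ χ ⟨f x, ·⟩` is an open embedding (corestrictions to open subtypes: `Topology.IsOpenEmbedding.of_comp` with
`Subtype.val`). [folklore] -/
private theorem deviationTransport_isOpenEmbedding_restrict {Y : Type*} [TopologicalSpace Y]
    {K : TopologicalSpace.Opens E4} {χ : K → Y} {W : Set K} (hW : IsOpen W)
    (hχe : Topology.IsOpenEmbedding (W.restrict χ))
    {P : Set E4} (hP : IsOpen P) {f : E4 → E4} (hfe : Topology.IsOpenEmbedding (P.restrict f))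
    {U : TopologicalSpace.Opens E4} (hU : (U : Set E4) = P) (hfK : ∀ x : U, f x.1 ∈ K)
    (hfW : ∀ x : U, (⟨f x.1, hfK x⟩ : K) ∈ W) {L : Set U} (hL : IsOpen L) :
    Topology.IsOpenEmbedding (L.restrict fun x : U ↦ χ ⟨f x.1, hfK x⟩) := by
  have hUiff : ∀ y : E4, y ∈ U ↔ y ∈ P := fun y ↦ Set.ext_iff.1 hU y
  let k : L → P := fun z ↦ ⟨z.1.1, (hUiff z.1.1).1 z.1.2⟩
  have hk : Topology.IsOpenEmbedding k :=
    Topology.IsOpenEmbedding.of_comp k hP.isOpenEmbedding_subtypeVal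
      (U.isOpen.isOpenEmbedding_subtypeVal.comp hL.isOpenEmbedding_subtypeVal)
  have hF₀ : Topology.IsOpenEmbedding (fun z : L ↦ f z.1.1) := hfe.comp hk
  have hF₁ : Topology.IsOpenEmbedding (fun z : L ↦ (⟨f z.1.1, hfK z.1⟩ : K)) :=
    Topology.IsOpenEmbedding.of_comp _ K.isOpen.isOpenEmbedding_subtypeVal hF₀
  have hF₂ : Topology.IsOpenEmbedding (fun z : L ↦ (⟨⟨f z.1.1, hfK z.1⟩, hfW z.1⟩ : W)) :=
    Topology.IsOpenEmbedding.of_comp _ hW.isOpenEmbedding_subtypeVal hF₁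
  exact hχe.comp hF₂

/-- **The transport, for an abstract lab chart `f`.**  For a chart map `χ` into a spacetime `𝓢`, smooth, an open
embedding and isometric on the collar `W`, and `f : E4 → E4` smooth on `{x⁰ > τ₀}`, an open embedding of
`P = {x⁰ > τ₀, r > r₁}`, above the leaf and radius preserving, with explicit zero-extended deviation `e` decaying in
`C³` on the slabs of `P` and flat on the cone: the chart `Φ = χ ∘ f` on the open set `U` (underlying set `P`) is
smooth, an open embedding of the late region, `deviationCk ⟨U, bK, x⁰, |x̲|⟩ Φ 3 t → 0` (`bK = g_{M,a}` pointwise) and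
the weighted cone suprema vanish identically (registered helper sub-goal of T6 on crux stmt-FinalStateConjecture-10167,
stated in `∀`-form).  O'Neill 1983, Ch. 3, p. 58; DHRT arXiv:2104.08222, §1. [folklore] -/
theorem deviationTransport_of_chart :
    open Literature.Geometry.Lorentzian Summit.FinalStateConjecture.FinalStateConjecture.Theorems.KerrShieldedDataExist.Negative in
    ∀ [Kerr.Facts] {M a r₁ τ₀ : ℝ}, 0 < M → 0 ≤ r₁ → ∀ {𝓢 : Spacetime.{0} 4} {χ : Kerr.region a r₁ → 𝓢.carrier},
    ContMDiffOn 𝓘(ℝ, E4) (𝓡 4) ((⊤ : ℕ∞) : WithTop ℕ∞) χ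
        {x : Kerr.region a r₁ | 0 < (x : E4) 0 - bentHeight M a (Kerr.radius a (x : E4)) + (Kerr.radius a (x : E4) - r₁) / 4} →
    Topology.IsOpenEmbedding (Set.restrict
        {x : Kerr.region a r₁ | 0 < (x : E4) 0 - bentHeight M a (Kerr.radius a (x : E4)) + (Kerr.radius a (x : E4) - r₁) / 4} χ) →
    (∀ x : Kerr.region a r₁, 0 < (x : E4) 0 - bentHeight M a (Kerr.radius a (x : E4)) + (Kerr.radius a (x : E4) - r₁) / 4 →
      ∀ v w : E4, 𝓢.metric.val (χ x) (mfderiv 𝓘(ℝ, E4) (𝓡 4) χ x v) (mfderiv 𝓘(ℝ, E4) (𝓡 4) χ x w) =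
        Kerr.bilin M a (x : E4) v w) →
    ∀ {f : E4 → E4}, ContDiffOn ℝ ((⊤ : ℕ∞) : WithTop ℕ∞) f {x : E4 | τ₀ < x 0} →
    Topology.IsOpenEmbedding ({x : E4 | τ₀ < x 0 ∧ r₁ < Kerr.radius a x}.restrict f) →
    (∀ x : E4, τ₀ < x 0 → bentHeight M a (Kerr.radius a x) < (f x) 0) →
    (∀ x : E4, Kerr.radius a (f x) = Kerr.radius a x) →
    Tendsto (fun t : ℝ ↦ supCkENorm {x : E4 | (τ₀ < x 0 ∧ r₁ < Kerr.radius a x) ∧ x 0 = t} 3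
      (fun x : E4 ↦ if τ₀ < x 0 ∧ r₁ < Kerr.radius a x then
        (Kerr.bilin M a (f x)).bilinearComp (fderiv ℝ f x) (fderiv ℝ f x) - Kerr.bilin M a x else 0)) atTop (𝓝 0) →
    (∀ x : E4, τ₀ < x 0 → E4.spatialNorm x ≤ x 0 / 2 → ∀ m : ℕ,
      iteratedFDeriv ℝ m (fun x : E4 ↦ if τ₀ < x 0 ∧ r₁ < Kerr.radius a x then
        (Kerr.bilin M a (f x)).bilinearComp (fderiv ℝ f x) (fderiv ℝ f x) - Kerr.bilin M a x else 0) x = 0) →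
    ∀ {bK : E4 → E4 →L[ℝ] E4 →L[ℝ] ℝ}, (∀ x : E4, bK x = Kerr.bilin M a x) →
    ∀ {U : TopologicalSpace.Opens E4}, (U : Set E4) = {x : E4 | τ₀ < x 0 ∧ r₁ < Kerr.radius a x} →
    ∀ {Φ : U → 𝓢.carrier}, (∀ (x : U) (hx : f x.1 ∈ Kerr.region a r₁), Φ x = χ ⟨f x.1, hx⟩) →
    ContMDiff 𝓘(ℝ, E4) (𝓡 4) ((⊤ : ℕ∞) : WithTop ℕ∞) Φ ∧
    Topology.IsOpenEmbedding
      (((ModelBackground.mk U bK (fun x ↦ x 0) E4.spatialNorm).lateRegion τ₀).restrict Φ) ∧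
    Tendsto (fun t ↦ 𝓢.deviationCk (ModelBackground.mk U bK (fun x ↦ x 0) E4.spatialNorm) Φ 3 t) atTop (𝓝 0) ∧
    ∀ w : ℝ → E4 → ℝ≥0∞,
      Tendsto (fun t : ℝ ↦ ⨆ x ∈ {x : U | x.1 0 = t ∧ E4.spatialNorm x.1 ≤ 1 / 2 * t}, ⨆ (m : ℕ) (_ : m ≤ 3),
        w t x.1 * ‖iteratedFDeriv ℝ m
          (𝓢.deviationExtend (ModelBackground.mk U bK (fun x ↦ x 0) E4.spatialNorm) Φ) x.1‖ₑ) atTop (𝓝 0) := by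
  intro _ M a r₁ τ₀ hM0 hr₁0 𝓢 χ hχs hχe hiso f hfs hfe hleaf hrad hdev hcone bK hbK U hU Φ hΦ
  -- the pinned domain and the late region
  have hPo : IsOpen {x : E4 | τ₀ < x 0 ∧ r₁ < Kerr.radius a x} :=
    (isOpen_lt continuous_const (PiLp.continuous_apply 2 _ 0)).inter
      (isOpen_lt continuous_const (Kerr.continuous_radius a))
  have hUiff : ∀ y : E4, y ∈ U ↔ τ₀ < y 0 ∧ r₁ < Kerr.radius a y := fun y ↦ Set.ext_iff.1 hU y
  have hmemU : ∀ x : U, τ₀ < x.1 0 ∧ r₁ < Kerr.radius a x.1 := fun x ↦ (hUiff x.1).1 x.2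
  set B : ModelBackground := ModelBackground.mk U bK (fun x ↦ x 0) E4.spatialNorm with hB
  have hL : B.lateRegion τ₀ = univ := eq_univ_of_forall fun x ↦ (hmemU x).1
  -- the lab chart as a map of open subsets of `E4`
  have hO : IsOpen {x : E4 | τ₀ < x 0} := isOpen_lt continuous_const (PiLp.continuous_apply 2 _ 0)
  have hfc : ∀ y : E4, τ₀ < y 0 → ContDiffAt ℝ ∞ f y := fun y hy ↦ hfs.contDiffAt (hO.mem_nhds hy)
  have hfd : ∀ y : E4, τ₀ < y 0 → DifferentiableAt ℝ f y := fun y hy ↦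
    (hfc y hy).differentiableAt (by simp)
  have hfmem : ∀ x : U, f x.1 ∈ Kerr.region a r₁ := fun x ↦ by
    rw [Kerr.mem_region, max_eq_left hr₁0, hrad]
    exact (hmemU x).2
  set Ψ : U → Kerr.region a r₁ := fun x ↦ ⟨f x.1, hfmem x⟩ with hΨ
  have hΨs : ContMDiff 𝓘(ℝ, E4) 𝓘(ℝ, E4) ∞ Ψ :=
    contMDiff_of_repr Ψ f (fun _ ↦ rfl) fun y ↦ hfc y.1 (hmemU y).1
  have hΨW : ∀ x : U, 0 < (Ψ x : E4) 0 - bentHeight M a (Kerr.radius a (Ψ x : E4)) +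
      (Kerr.radius a (Ψ x : E4) - r₁) / 4 := fun x ↦ by
    have h1 := hleaf x.1 (hmemU x).1
    have h2 := (hmemU x).2
    show 0 < (f x.1) 0 - bentHeight M a (Kerr.radius a (f x.1)) + (Kerr.radius a (f x.1) - r₁) / 4
    rw [hrad]
    linarith
  have hΦΨ : Φ = χ ∘ Ψ := funext fun x ↦ hΦ x (hfmem x)
  -- the deviation of `Φ` is the explicit zero-extended deviation of `f`
  have hdevΦ : 𝓢.deviation B (χ ∘ Ψ) = (Kerr.spacetime M a r₁ hM0.le).deviation B Ψ :=
    deviation_comp_eq hM0 hχs hiso B hΨs hΨW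
  have hext : 𝓢.deviationExtend B (χ ∘ Ψ) = fun x : E4 ↦ if τ₀ < x 0 ∧ r₁ < Kerr.radius a x then
      (Kerr.bilin M a (f x)).bilinearComp (fderiv ℝ f x) (fderiv ℝ f x) - Kerr.bilin M a x else 0 := by
    funext y
    by_cases hy : τ₀ < y 0 ∧ r₁ < Kerr.radius a y
    · have hyU : y ∈ U := (hUiff y).2 hy
      rw [if_pos hy]
      refine (𝓢.deviationExtend_coe B (χ ∘ Ψ) ⟨y, hyU⟩).trans ?_
      rw [hdevΦ]
      ext v w
      have hBb : B.bilin = bK := rfl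
      rw [deviation_of_repr hM0.le B Ψ f (fun _ ↦ rfl) ⟨y, hyU⟩ (hfd y hy.1) v w]
      simp only [sub_apply, ContinuousLinearMap.bilinearComp_apply, hBb, hbK]
    · have hyU : y ∉ U := fun h ↦ hy ((hUiff y).1 h)
      rw [if_neg hy]
      exact 𝓢.deviationExtend_of_not_mem B (χ ∘ Ψ) hyU
  have hslab : ∀ t : ℝ, Subtype.val '' B.timeSlab t =
      {x : E4 | (τ₀ < x 0 ∧ r₁ < Kerr.radius a x) ∧ x 0 = t} := fun t ↦ by
    ext y
    constructor
    · rintro ⟨x, hx, rfl⟩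
      exact ⟨hmemU x, hx⟩
    · rintro ⟨hy, hyt⟩
      exact ⟨⟨y, (hUiff y).2 hy⟩, hyt, rfl⟩
  rw [hΦΨ]
  refine ⟨hχs.comp_contMDiff hΨs hΨW, ?_, ?_, fun w ↦ ?_⟩
  · -- open embedding of the late region (= all of `U`)
    exact deviationTransport_isOpenEmbedding_restrict (collar M a r₁ hM0).isOpen hχe hPo hfe hU hfmem hΨW
      (hL ▸ isOpen_univ)
  · -- the `C³` deviation on the lab slabs
    have hCk : (fun t ↦ 𝓢.deviationCk B (χ ∘ Ψ) 3 t) = fun t ↦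
        supCkENorm {x : E4 | (τ₀ < x 0 ∧ r₁ < Kerr.radius a x) ∧ x 0 = t} 3
          (fun x : E4 ↦ if τ₀ < x 0 ∧ r₁ < Kerr.radius a x then
            (Kerr.bilin M a (f x)).bilinearComp (fderiv ℝ f x) (fderiv ℝ f x) - Kerr.bilin M a x else 0) := by
      funext t
      unfold Spacetime.deviationCk
      rw [hslab, hext]
    rw [hCk]
    exact hdev
  · -- the weighted cone supremum vanishes identically
    have hzero : (fun t : ℝ ↦ ⨆ x ∈ {x : U | x.1 0 = t ∧ E4.spatialNorm x.1 ≤ 1 / 2 * t},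
        ⨆ (m : ℕ) (_ : m ≤ 3), w t x.1 * ‖iteratedFDeriv ℝ m (𝓢.deviationExtend B (χ ∘ Ψ)) x.1‖ₑ) =
        fun _ ↦ 0 := by
      funext t
      refine le_antisymm (iSup₂_le fun x hx ↦ iSup₂_le fun m _ ↦ ?_) zero_le
      obtain ⟨hxt, hxn⟩ := hx
      have hn : E4.spatialNorm x.1 ≤ x.1 0 / 2 := by
        rw [hxt]
        linarith
      rw [hext, hcone x.1 (hmemU x).1 hn m, enorm_zero, mul_zero]
    rw [hzero]
    exact tendsto_const_nhds

/-- **T6 `stub_deviationTransport` — transport of the chart and deviation clauses through `χ`.**  Given a chart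
map `χ : Kerr.region a r₁ → 𝒟` smooth / open embedding / isometric (and oriented) on the tapered collar
`W = {0 < x⁰ − T(r) + (r − r₁)/4}` (`T = bentHeight M a`), the bent lab chart
`f(x) = x + χ₁(|x̲|/x⁰ − 1) · T(|x̲|) e₀` with its T2 facts at `rin = r₁` (smooth on `{x⁰ > τ₀}`, open embedding of
`{x⁰ > τ₀, r > r₁}`, above the leaf `T(r x) < (f x)⁰`, spatial point and radius preserved) and its T3 facts (the
zero-extended explicit deviation `e = 𝟙 · (g_{M,a}(f ·)(Df ·, Df ·) − g_{M,a})` decays in `C³` on the lab slabs and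
is flat on the cone `|x̲| ≤ x⁰/2`), a reference form `bK = g_{M,a}` pointwise, the pinned domain
`U = {x⁰ > τ₀, r > r₁}` and `Φ = χ ∘ f` on `U`: `Φ` is smooth, an open embedding of the late region of
`⟨U, bK, x⁰, |x̲|⟩` (all of `U`), `deviationCk ⟨U, bK, x⁰, |x̲|⟩ Φ 3 t → 0`, and for EVERY weight `w` the weighted
`C³` cone supremum tends to `0` (it vanishes identically).  Proof: `f(U) ⊆ W` (above the leaf, radius preserved), so
`Φ = χ ∘ Ψ` with `Ψ = f|_U : U → Kerr.region a r₁` smooth (`ExteriorDecomposition.contMDiff_of_repr`) and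
`ContMDiffOn.comp_contMDiff`; the open embedding is `χ|_W ∘ (corestriction of f|_U)`
(`Topology.IsOpenEmbedding.of_comp` with the open subtypes); the deviation is blind to `χ`
(`ExteriorTransport.deviation_comp_eq`, crux 10054) and that of `Ψ` in exact Kerr is `e` on `U`
(`ExteriorDecomposition.deviation_of_repr`, `deviationExtend_coe/_of_not_mem`), while
`Subtype.val '' timeSlab t = {x ∈ U | x⁰ = t}`; the cone clause is killed termwise by the flatness hypothesis.
O'Neill 1983, Ch. 3, p. 58; DHRT arXiv:2104.08222, §1. -/
theorem stub_deviationTransport : ∀ [Kerr.Facts] (X : Type) [TopologicalSpace X] [ChartedSpace E3 X]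
    [IsManifold (𝓡 3) ((⊤ : ℕ∞) : WithTop ℕ∞) X] [T2Space X] [SecondCountableTopology X] [ConnectedSpace X]
    (D : InitialDataSet (𝓡 3) X) (M a r₁ : ℝ),
    |a| < M → Kerr.rMinus M a < r₁ → r₁ < Kerr.rPlus M a →
    ∀ (𝒟 : VacuumCauchyDevelopment D) (χ : Kerr.region a r₁ → 𝒟.carrier),
      ContMDiffOn 𝓘(ℝ, E4) (𝓡 4) ((⊤ : ℕ∞) : WithTop ℕ∞) χ
          {x : Kerr.region a r₁ | 0 < (x : E4) 0 - bentHeight M a (Kerr.radius a (x : E4)) +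
            (Kerr.radius a (x : E4) - r₁) / 4} →
      Topology.IsOpenEmbedding (Set.restrict
          {x : Kerr.region a r₁ | 0 < (x : E4) 0 - bentHeight M a (Kerr.radius a (x : E4)) +
            (Kerr.radius a (x : E4) - r₁) / 4} χ) →
      (∀ x : Kerr.region a r₁, 0 < (x : E4) 0 - bentHeight M a (Kerr.radius a (x : E4)) +
            (Kerr.radius a (x : E4) - r₁) / 4 →
          (∀ v w : E4, 𝒟.metric.val (χ x) (mfderiv 𝓘(ℝ, E4) (𝓡 4) χ x v)
              (mfderiv 𝓘(ℝ, E4) (𝓡 4) χ x w) = Kerr.bilin M a (x : E4) v w) ∧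
          𝒟.metric.val (χ x) (𝒟.timeOrientation.vectorField (χ x))
              (mfderiv 𝓘(ℝ, E4) (𝓡 4) χ x (Kerr.timeVector M a (x : E4))) < 0) →
      ∀ τ₀ : ℝ, 0 < τ₀ →
      -- T2 at `rin = r₁` (smoothness, open embedding, above the leaf, spatial point preserved)
      ContDiffOn ℝ ((⊤ : ℕ∞) : WithTop ℕ∞)
        (fun x : E4 ↦ x + (Real.smoothTransition (E4.spatialNorm x / x 0 - 1) *
            bentHeight M a (E4.spatialNorm x)) • E4.basisVector 0)
        {x : E4 | τ₀ < x 0} →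
      Topology.IsOpenEmbedding ({x : E4 | τ₀ < x 0 ∧ r₁ < Kerr.radius a x}.restrict
        (fun x : E4 ↦ x + (Real.smoothTransition (E4.spatialNorm x / x 0 - 1) *
            bentHeight M a (E4.spatialNorm x)) • E4.basisVector 0)) →
      (∀ x : E4, τ₀ < x 0 → bentHeight M a (Kerr.radius a x) <
        ((fun x : E4 ↦ x + (Real.smoothTransition (E4.spatialNorm x / x 0 - 1) *
            bentHeight M a (E4.spatialNorm x)) • E4.basisVector 0) x) 0) →
      (∀ x : E4,
        E4.spatial ((fun x : E4 ↦ x + (Real.smoothTransition (E4.spatialNorm x / x 0 - 1) *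
            bentHeight M a (E4.spatialNorm x)) • E4.basisVector 0) x) = E4.spatial x ∧
        Kerr.radius a ((fun x : E4 ↦ x + (Real.smoothTransition (E4.spatialNorm x / x 0 - 1) *
            bentHeight M a (E4.spatialNorm x)) • E4.basisVector 0) x) = Kerr.radius a x ∧
        ((fun x : E4 ↦ x + (Real.smoothTransition (E4.spatialNorm x / x 0 - 1) *
            bentHeight M a (E4.spatialNorm x)) • E4.basisVector 0) x) 0 = x 0 + Real.smoothTransition (E4.spatialNorm x / x 0 - 1) * bentHeight M a (E4.spatialNorm x)) →
      -- T3 at `rin = r₁`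
      Tendsto (fun t : ℝ ↦ supCkENorm {x : E4 | (τ₀ < x 0 ∧ r₁ < Kerr.radius a x) ∧ x 0 = t} 3
        (fun x : E4 ↦ if τ₀ < x 0 ∧ r₁ < Kerr.radius a x then
          (Kerr.bilin M a ((fun x : E4 ↦ x + (Real.smoothTransition (E4.spatialNorm x / x 0 - 1) *
            bentHeight M a (E4.spatialNorm x)) • E4.basisVector 0) x)).bilinearComp
              (fderiv ℝ (fun x : E4 ↦ x + (Real.smoothTransition (E4.spatialNorm x / x 0 - 1) *
            bentHeight M a (E4.spatialNorm x)) • E4.basisVector 0) x)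
              (fderiv ℝ (fun x : E4 ↦ x + (Real.smoothTransition (E4.spatialNorm x / x 0 - 1) *
            bentHeight M a (E4.spatialNorm x)) • E4.basisVector 0) x) - Kerr.bilin M a x
          else 0)) atTop (𝓝 0) →
      (∀ x : E4, τ₀ < x 0 → E4.spatialNorm x ≤ x 0 / 2 → ∀ m : ℕ,
        iteratedFDeriv ℝ m (fun x : E4 ↦ if τ₀ < x 0 ∧ r₁ < Kerr.radius a x then
          (Kerr.bilin M a ((fun x : E4 ↦ x + (Real.smoothTransition (E4.spatialNorm x / x 0 - 1) *
            bentHeight M a (E4.spatialNorm x)) • E4.basisVector 0) x)).bilinearComp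
              (fderiv ℝ (fun x : E4 ↦ x + (Real.smoothTransition (E4.spatialNorm x / x 0 - 1) *
            bentHeight M a (E4.spatialNorm x)) • E4.basisVector 0) x)
              (fderiv ℝ (fun x : E4 ↦ x + (Real.smoothTransition (E4.spatialNorm x / x 0 - 1) *
            bentHeight M a (E4.spatialNorm x)) • E4.basisVector 0) x) - Kerr.bilin M a x
          else 0) x = 0) →
      -- the background form, the pinned domain and the chart
      ∀ (bK : E4 → E4 →L[ℝ] E4 →L[ℝ] ℝ), (∀ x : E4, bK x = Kerr.bilin M a x) →
      ∀ (U : Opens E4), (U : Set E4) = {x : E4 | τ₀ < x 0 ∧ r₁ < Kerr.radius a x} →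
      ∀ (Φ : U → 𝒟.carrier),
        (∀ (x : U) (hx : (fun x : E4 ↦ x + (Real.smoothTransition (E4.spatialNorm x / x 0 - 1) *
            bentHeight M a (E4.spatialNorm x)) • E4.basisVector 0) x.1 ∈ Kerr.region a r₁), Φ x = χ ⟨(fun x : E4 ↦ x + (Real.smoothTransition (E4.spatialNorm x / x 0 - 1) *
            bentHeight M a (E4.spatialNorm x)) • E4.basisVector 0) x.1, hx⟩) →
      ContMDiff 𝓘(ℝ, E4) (𝓡 4) ((⊤ : ℕ∞) : WithTop ℕ∞) Φ ∧
      Topology.IsOpenEmbedding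
        (((ModelBackground.mk U bK (fun x ↦ x 0) E4.spatialNorm).lateRegion τ₀).restrict Φ) ∧
      Tendsto (fun t ↦ 𝒟.toSpacetime.deviationCk (ModelBackground.mk U bK (fun x ↦ x 0) E4.spatialNorm) Φ 3 t)
        atTop (𝓝 0) ∧
      ∀ w : ℝ → E4 → ℝ≥0∞,
        Tendsto (fun t : ℝ ↦ ⨆ x ∈ {x : U | x.1 0 = t ∧ E4.spatialNorm x.1 ≤ 1 / 2 * t}, ⨆ (m : ℕ) (_ : m ≤ 3),
          w t x.1 * ‖iteratedFDeriv ℝ m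
            (𝒟.toSpacetime.deviationExtend (ModelBackground.mk U bK (fun x ↦ x 0) E4.spatialNorm) Φ) x.1‖ₑ)
          atTop (𝓝 0) := by
  intro _ X _ _ _ _ _ _ D M a r₁ ha hr₁ _ 𝒟 χ hχs hχe hχg τ₀ _ hfs hfe hleaf hpres hdev hcone bK hbK U hU Φ hΦ
  exact deviationTransport_of_chart (𝓢 := 𝒟.toSpacetime) (mass_pos ha) ((rMinus_nonneg ha).trans hr₁.le) hχs hχe
    (fun x hx ↦ (hχg x hx).1) hfs hfe hleaf (fun x ↦ (hpres x).2.1) hdev hcone hbK hU hΦ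

end Summit.FinalStateConjecture.FinalStateConjecture.Cruxes.ModulatedKerrHandoff.SwallowTransfer

end
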